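import Mathlib.RepresentationTheory.Homological.GroupCohomology.Basic
import Mathlib.Algebra.BigOperators.Fin
import HarnessLib

/-!
# Homogeneous cochains and Mathlib's inhomogeneous cochains: the partial-product dictionary

Mathlib computes group cohomology `Hⁿ(G, A)` (`groupCohomology A n`) with INHOMOGENEOUS cochains
`f : (Fin n → G) → A` and the differential `inhomogeneousCochains.d`,
`(d f)(g₀, …, g_n) = g₀ • f(g₁, …, g_n) + ∑ⱼ (-1)^{j+1} f(g₀, …, gⱼ gⱼ₊₁, …, g_n) + (-1)^{n+1} f(g₀, …, g_{n-1})`.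
Geometric constructions (integration of equivariant differential forms over straight / geodesic
simplices: Dupont's simplicial de Rham map, the Eichler–Shimura–Borel realisation of automorphic forms
in the cohomology of arithmetic groups, Eisenstein cocycles) produce instead HOMOGENEOUS cochains
`F : (Fin (n + 1) → G) → A`, `G`-equivariant (`F(γ g₀, …, γ g_n) = γ • F(g₀, …, g_n)`), with the
simplicial coboundary `(δF)(P₀, …, P_{n+1}) = ∑ᵢ (-1)ⁱ F(P₀, …, P̂ᵢ, …, P_{n+1})`.  The classical
dictionary is `f(g₁, …, g_n) = F(1, g₁, g₁g₂, …, g₁⋯g_n) = F(Fin.partialProd g)`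
[cite: Brown1982CohomologyGroups, III §1 (p. 59), I §5].  This file proves the one identity that makes
the dictionary usable with Mathlib's definition:

* `inhomogeneousCochains_d_comp_partialProd` — for `G`-equivariant `H`,
  `d (H ∘ partialProd) (g) = ∑ᵢ (-1)ⁱ H(partialProd g ∘ Fin.succAbove i) = (δH)(partialProd g)`
  (Mathlib's `Fin.partialProd_contractNth` and `Fin.partialProd_succ'`);
* `inhomogeneousCochains_d_comp_partialProd_eq_zero` — an equivariant homogeneous COCYCLE gives an
  inhomogeneous cocycle (so a class through `groupCohomology.cocyclesMk` / `groupCohomology.π`);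
* `comp_partialProd_eq_d_comp_partialProd` — the homogeneous coboundary of an equivariant `H`
  corresponds to the inhomogeneous coboundary of `H ∘ partialProd`.

Theorems only (no definitions, no named facts).

## References

* K. S. Brown, *Cohomology of Groups*, GTM 87, Springer 1982, I §5 (the standard and bar resolutions),
  III §1 (p. 59: homogeneous vs inhomogeneous cochains). [Brown1982CohomologyGroups]
* J. L. Dupont, Topology 15 (1976), §1–2 (simplicial cochains from differential forms). [Dupont1976]
-/

noncomputable section

open CategoryTheory

universe u

namespace Literature.Algebra.Homology

variable {k G : Type u} [CommRing k] [Group G] (A : Rep k G) {q : ℕ}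

/-- The partial products of `(g₀, …, g_q)` with the first one removed are the left translates by `g₀`
of the partial products of the tail: `(g₀, g₀g₁, …) = g₀ • (1, g₁, g₁g₂, …)`
(`Fin.partialProd_succ'`). [folklore] -/
theorem partialProd_succAbove_zero (g : Fin (q + 1) → G) (j : Fin (q + 1)) :
    Fin.partialProd g ((0 : Fin (q + 2)).succAbove j) =
      g 0 * Fin.partialProd (fun i : Fin q => g i.succ) j := by
  rw [Fin.succAbove_zero, Fin.partialProd_succ']
  rfl

/-- The partial products of `g` with the `(j+1)`-st removed are the partial products of `g` with
`gⱼ, gⱼ₊₁` contracted (`Fin.partialProd_contractNth`). [folklore] -/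
theorem partialProd_succAbove_succ (g : Fin (q + 1) → G) (j : Fin (q + 1)) (i : Fin (q + 1)) :
    Fin.partialProd g (j.succ.succAbove i) = Fin.partialProd (j.contractNth (· * ·) g) i := by
  rw [Fin.partialProd_contractNth]
  rfl

/-- **The dictionary identity.**  For a `G`-equivariant homogeneous cochain
`H : (Fin (q+1) → G) → A`, Mathlib's inhomogeneous differential of `H ∘ Fin.partialProd` is the
simplicial coboundary of `H` evaluated on partial products:
`d (H ∘ partialProd) (g) = ∑ᵢ (-1)ⁱ H (partialProd g ∘ Fin.succAbove i)`.
[cite: Brown1982CohomologyGroups, III §1 (p. 59)] -/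
theorem inhomogeneousCochains_d_comp_partialProd (H : (Fin (q + 1) → G) → A)
    (hH : ∀ (γ : G) (g : Fin (q + 1) → G), H (fun i => γ * g i) = A.ρ γ (H g))
    (g : Fin (q + 1) → G) :
    (inhomogeneousCochains.d A q fun g' => H (Fin.partialProd g')) g =
      ∑ i : Fin (q + 2), (-1 : k) ^ (i : ℕ) • H fun j => Fin.partialProd g (i.succAbove j) := by
  rw [inhomogeneousCochains.d_hom_apply]
  conv_rhs => rw [Fin.sum_univ_succ]
  congr 1
  · simp only [Fin.val_zero, pow_zero, one_smul, partialProd_succAbove_zero, hH]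
  · refine Finset.sum_congr rfl fun j _ => ?_
    simp only [Fin.val_succ, partialProd_succAbove_succ]

/-- **Equivariant homogeneous cocycles give inhomogeneous cocycles**: if moreover the simplicial
coboundary of `F` vanishes, `∑ᵢ (-1)ⁱ F(P ∘ succAbove i) = 0` for all `P`, then
`d (F ∘ partialProd) = 0`. [cite: Brown1982CohomologyGroups, III §1 (p. 59)] -/
theorem inhomogeneousCochains_d_comp_partialProd_eq_zero (F : (Fin (q + 1) → G) → A)
    (hF : ∀ (γ : G) (g : Fin (q + 1) → G), F (fun i => γ * g i) = A.ρ γ (F g))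
    (hcoc : ∀ P : Fin (q + 2) → G,
      ∑ i : Fin (q + 2), (-1 : k) ^ (i : ℕ) • F (fun j => P (i.succAbove j)) = 0) :
    (inhomogeneousCochains.d A q fun g => F (Fin.partialProd g)) = 0 := by
  funext g
  rw [inhomogeneousCochains_d_comp_partialProd A F hF g]
  exact hcoc _

/-- **Homogeneous coboundaries give inhomogeneous coboundaries**: if `F = δH` for an equivariant
homogeneous `H`, i.e. `F P = ∑ᵢ (-1)ⁱ H(P ∘ succAbove i)`, then
`F ∘ partialProd = d (H ∘ partialProd)`. [cite: Brown1982CohomologyGroups, III §1 (p. 59)] -/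
theorem comp_partialProd_eq_d_comp_partialProd (F : (Fin (q + 2) → G) → A)
    (H : (Fin (q + 1) → G) → A)
    (hH : ∀ (γ : G) (g : Fin (q + 1) → G), H (fun i => γ * g i) = A.ρ γ (H g))
    (hFH : ∀ P : Fin (q + 2) → G,
      F P = ∑ i : Fin (q + 2), (-1 : k) ^ (i : ℕ) • H (fun j => P (i.succAbove j))) :
    (fun g : Fin (q + 1) → G => F (Fin.partialProd g)) =
      inhomogeneousCochains.d A q fun g => H (Fin.partialProd g) := by
  funext g
  rw [inhomogeneousCochains_d_comp_partialProd A H hH g]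
  exact hFH _

/-- The inhomogeneous cochain of an equivariant homogeneous cocycle, as an element of Mathlib's
`n`-cocycles `Zⁿ(G, A)`. [cite: Brown1982CohomologyGroups, III §1 (p. 59)] -/
theorem iCocycles_cocyclesMk_comp_partialProd (F : (Fin (q + 1) → G) → A)
    (hF : ∀ (γ : G) (g : Fin (q + 1) → G), F (fun i => γ * g i) = A.ρ γ (F g))
    (hcoc : ∀ P : Fin (q + 2) → G,
      ∑ i : Fin (q + 2), (-1 : k) ^ (i : ℕ) • F (fun j => P (i.succAbove j)) = 0) :
    groupCohomology.iCocycles A q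
        (groupCohomology.cocyclesMk (fun g => F (Fin.partialProd g))
          (inhomogeneousCochains_d_comp_partialProd_eq_zero A F hF hcoc)) =
      fun g => F (Fin.partialProd g) :=
  groupCohomology.iCocycles_mk _ _

end Literature.Algebra.Homology

end
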